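import Mathlib
import Summits.QuantumFields.YangMills.Theses.CoarseStiffnessTail
import Summits.QuantumFields.YangMills.Theorems.SmallFieldWideningLargeFieldMassRefinementTailSubGaussianRung

/-!
# Route `CoarseStiffnessTail`, crux `CappedCoarseStiffnessL` (stmt-QuantumFields-25301), line `birth` — STRENGTH CERTIFICATE:
# the open stub `stub_tiltedCappedMoment` is NOT a strengthening of the crux (the skeleton's split is lossless up to constants)

Prover seat `ym-line-cst-p1` (g0), support file (`--supports stmt-QuantumFields-25301`).  The registered birth skeleton (lead's reshape r1,
`Cruxes/CappedCoarseStiffnessL/Lines/birth.lean`, sha e8a582e9) proves `CappedCoarseStiffnessL ⇐ stub_cgfConvexCapped (LANDED) +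
stub_tiltedCappedMoment (OPEN, XL)`.  THIS FILE proves the CONVERSE direction `CappedCoarseStiffnessL ⇒ (the statement of stub_tiltedCappedMoment)`
(`tiltedCappedMoment_of_cappedCoarseStiffness`), so the remaining stub is EQUIVALENT to the crux up to the constants `(c₀, C₀) ↦ (c₀/2, 2C₀/c₀)`:
a siege on the stub is a siege on the crux itself, no more.  The instrument row JOB A of `ym-r3-instr-1` (09:45Z, GUIDANCE) reads PASS-lean for the
crux at toy scale; nothing numerical is used here.

* §1 `mul_tilted_mean_le_log_sub_log` — the CHORD INEQUALITY of the convex cumulant generating function: for a probability measure, a bounded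
  measurable `X`, any `c` and `t`: `t·(∫X e^{cX}/∫e^{cX}) ≤ log ∫e^{(c+t)X} − log ∫e^{cX}` (Jensen for `exp` under the tilted law `μ.tilted (cX)`
  applied to `tX`); and `one_le_integral_exp_mul` (`X ≥ 0`, `c ≥ 0` ⇒ `1 ≤ ∫e^{cX}`).
* §2 `tiltedCappedMoment_of_cappedCoarseStiffness` — the certificate, for the capped stiffness `X_j = β_{K−j}·Σ_a min(|Ū^j(∂a) − 1|², θ(K−j)²)`.

HONEST SCOPE.  Soft convexity; the crux and its open stub stay OPEN and XL; no rung, leaf or summit is proved (R3 record rung; `YM3TorusSU2` NOT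
proved; the Yang–Mills mass gap is NOT touched).
-/

noncomputable section

namespace Summit.QuantumFields.YangMills.Theorems.CoarseStiffnessTailCappedCoarseStiffnessLStrength

open MeasureTheory
open Literature.MathematicalPhysics.QuantumFieldTheory
open Literature.MathematicalPhysics.QuantumFieldTheory.Balaban1983to89
open Literature.MathematicalPhysics.QuantumFieldTheory.Balaban1983to89.T3ContinuumYM3Torus
open Summit.QuantumFields.YangMills.Theorems.LargeFieldMassRefinementTailSubGaussianRung (measurable_dist1_iter)

/-! ## §1 The chord inequality of the cumulant generating function -/

section Chord

variable {Ω : Type*} [MeasurableSpace Ω]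

/-- A bounded measurable real function is integrable for every finite measure (plumbing; same as the sibling file's
`CoarseStiffnessTailCappedCoarseStiffnessLCgfConvex.integrable_of_abs_le`, not imported to keep this module out of that file's cone). [folklore] -/
private theorem integrable_of_abs_le (μ : Measure Ω) [IsFiniteMeasure μ] {f : Ω → ℝ} (hf : Measurable f) {B : ℝ}
    (hB : ∀ x, |f x| ≤ B) : Integrable f μ :=
  (integrable_const B).mono' hf.aestronglyMeasurable (ae_of_all _ fun x => by rw [Real.norm_eq_abs]; exact hB x)

/-- **CHORD INEQUALITY** (`Λ` convex): for a probability measure `μ`, a bounded measurable `X` and real `c`, `t`,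
`t·(∫ X e^{cX} dμ / ∫ e^{cX} dμ) ≤ log ∫ e^{(c+t)X} dμ − log ∫ e^{cX} dμ` — Jensen for `exp` under the tilted law `μ.tilted (cX)` applied to
`tX`: `exp(E_{tilted}[tX]) ≤ E_{tilted}[e^{tX}] = ∫e^{(c+t)X}/∫e^{cX}`. [folklore] -/
theorem mul_tilted_mean_le_log_sub_log (μ : Measure Ω) [IsProbabilityMeasure μ] {X : Ω → ℝ} (hX : Measurable X) {B : ℝ}
    (hB : ∀ x, |X x| ≤ B) (c t : ℝ) :
    t * ((∫ x, X x * Real.exp (c * X x) ∂μ) / (∫ x, Real.exp (c * X x) ∂μ)) ≤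
      Real.log (∫ x, Real.exp ((c + t) * X x) ∂μ) - Real.log (∫ x, Real.exp (c * X x) ∂μ) := by
  -- integrability of the exponentials under `μ`
  have hexp_int : ∀ a : ℝ, Integrable (fun x => Real.exp (a * X x)) μ := fun a =>
    integrable_of_abs_le μ (Real.measurable_exp.comp (hX.const_mul a)) (B := Real.exp (|a| * B)) fun x => by
      rw [abs_of_pos (Real.exp_pos _)]
      refine Real.exp_le_exp.mpr ((le_abs_self _).trans ?_)
      rw [abs_mul]
      exact mul_le_mul_of_nonneg_left (hB x) (abs_nonneg a)
  set Z : ℝ := ∫ x, Real.exp (c * X x) ∂μ with hZdef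
  have hZ : 0 < Z := integral_exp_pos (hexp_int c)
  have hZ' : 0 < ∫ x, Real.exp ((c + t) * X x) ∂μ := integral_exp_pos (hexp_int (c + t))
  -- the tilted probability law
  set ν : Measure Ω := μ.tilted (fun x => c * X x) with hνdef
  haveI : IsProbabilityMeasure ν := isProbabilityMeasure_tilted (hexp_int c)
  -- Jensen for `exp` under `ν` applied to `tX`
  have hfν : Integrable (fun x => t * X x) ν :=
    integrable_of_abs_le ν (hX.const_mul t) (B := |t| * B) fun x => by
      rw [abs_mul]; exact mul_le_mul_of_nonneg_left (hB x) (abs_nonneg t)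
  have hgν : Integrable (Real.exp ∘ fun x => t * X x) ν := by
    refine integrable_of_abs_le ν (Real.measurable_exp.comp (hX.const_mul t)) (B := Real.exp (|t| * B)) fun x => ?_
    show |Real.exp (t * X x)| ≤ Real.exp (|t| * B)
    rw [abs_of_pos (Real.exp_pos _)]
    refine Real.exp_le_exp.mpr ((le_abs_self _).trans ?_)
    rw [abs_mul]
    exact mul_le_mul_of_nonneg_left (hB x) (abs_nonneg t)
  have hJ := ConvexOn.map_integral_le (μ := ν) convexOn_exp Real.continuous_exp.continuousOn isClosed_univ
    (ae_of_all _ fun x => Set.mem_univ (t * X x)) hfν hgν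
  -- both sides of Jensen in closed form
  have h1 : ∫ x, Real.exp (t * X x) ∂ν = (∫ x, Real.exp ((c + t) * X x) ∂μ) / Z := by
    have hint : (fun x => (Real.exp (c * X x) / ∫ x, Real.exp (c * X x) ∂μ) • Real.exp (t * X x)) =
        fun x => Real.exp ((c + t) * X x) / Z := by
      funext x
      simp only [smul_eq_mul, ← hZdef]
      rw [div_mul_eq_mul_div, ← Real.exp_add]
      congr 2
      ring
    rw [hνdef, integral_tilted, hint, integral_div]
  have h2 : ∫ x, t * X x ∂ν = t * ((∫ x, X x * Real.exp (c * X x) ∂μ) / Z) := by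
    have hint : (fun x => (Real.exp (c * X x) / ∫ x, Real.exp (c * X x) ∂μ) • (t * X x)) =
        fun x => t * (X x * Real.exp (c * X x) / Z) := by
      funext x
      simp only [smul_eq_mul, ← hZdef]
      ring
    rw [hνdef, integral_tilted, hint, integral_const_mul, integral_div]
  have hJ' : Real.exp (t * ((∫ x, X x * Real.exp (c * X x) ∂μ) / Z)) ≤ (∫ x, Real.exp ((c + t) * X x) ∂μ) / Z := by
    have := hJ
    rwa [h1, h2] at this
  -- take logarithms
  have h3 := Real.log_le_log (Real.exp_pos _) hJ'
  rwa [Real.log_exp, Real.log_div hZ'.ne' hZ.ne'] at h3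

/-- For `X ≥ 0` and `c ≥ 0` the tilted partition function is at least one: `1 ≤ ∫ e^{cX} dμ` (probability measure, `X` bounded
measurable). [folklore] -/
theorem one_le_integral_exp_mul (μ : Measure Ω) [IsProbabilityMeasure μ] {X : Ω → ℝ} (hX : Measurable X) {B : ℝ}
    (hB : ∀ x, |X x| ≤ B) (hX0 : ∀ x, 0 ≤ X x) {c : ℝ} (hc : 0 ≤ c) :
    1 ≤ ∫ x, Real.exp (c * X x) ∂μ := by
  have hexp_int : Integrable (fun x => Real.exp (c * X x)) μ :=
    integrable_of_abs_le μ (Real.measurable_exp.comp (hX.const_mul c)) (B := Real.exp (|c| * B)) fun x => by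
      rw [abs_of_pos (Real.exp_pos _)]
      refine Real.exp_le_exp.mpr ((le_abs_self _).trans ?_)
      rw [abs_mul]
      exact mul_le_mul_of_nonneg_left (hB x) (abs_nonneg c)
  calc (1 : ℝ) = ∫ _x, (1 : ℝ) ∂μ := by rw [integral_const, smul_eq_mul, probReal_univ, one_mul]
    _ ≤ ∫ x, Real.exp (c * X x) ∂μ :=
        integral_mono (integrable_const _) hexp_int fun x => Real.one_le_exp (mul_nonneg hc (hX0 x))

end Chord

/-! ## §2 The certificate: the crux implies the open stub's statement -/

/-- **STRENGTH CERTIFICATE — `CappedCoarseStiffnessL ⇒` (the statement of the open registered stub `stub_tiltedCappedMoment`)**: if the capped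
tilted partition functions obey `∫e^{c₁X_j} ≤ e^{C₁#Plaq_j}`, then at `c₀ = c₁/2` the tilted mean obeys `∫X_j e^{c₀X_j}/∫e^{c₀X_j} ≤ (2·max C₁ 0/c₁)·#Plaq_j`
— the chord inequality between `c₀` and `c₁` and `∫e^{c₀X_j} ≥ 1` (`X_j ≥ 0`).  Together with the skeleton (`Lines/birth.lean`:
stub ⇒ crux) the open stub is EQUIVALENT to the crux up to constants. [folklore] -/
theorem tiltedCappedMoment_of_cappedCoarseStiffness
    (hS : Summit.QuantumFields.YangMills.Theses.CoarseStiffnessTail.CappedCoarseStiffnessL) :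
    ∀ (L : ℕ) (b₀ p₀ : ℝ), 0 < b₀ → 2 < p₀ → ∃ (c₀ C₀ γ₁ : ℝ), 0 < c₀ ∧ 0 < γ₁ ∧ γ₁ ≤ 1 ∧
      ∀ (F : T3Family) (γ : ℝ), F.L = L → 0 < γ → γ ≤ γ₁ → ∀ (K j : ℕ), j ≤ K →
        (∫ U, ((γ * ((F.L : ℝ)⁻¹) ^ (K - j))⁻¹ *
          ∑ a : Plaq (F.P K) j, min (GaugeGroup.dist1 (GaugeField.plaqHol
            (Averaging.iter (fun i => BlockAveraging.blockAvg (P := F.P K) (j := i) T3UnitLawDensityEML.ℰp) j U) a) ^ 2)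
            (T3UnitScaleTilt.θBal F.L γ b₀ p₀ (K - j) ^ 2)) *
            Real.exp (c₀ * ((γ * ((F.L : ℝ)⁻¹) ^ (K - j))⁻¹ *
          ∑ a : Plaq (F.P K) j, min (GaugeGroup.dist1 (GaugeField.plaqHol
            (Averaging.iter (fun i => BlockAveraging.blockAvg (P := F.P K) (j := i) T3UnitLawDensityEML.ℰp) j U) a) ^ 2)
            (T3UnitScaleTilt.θBal F.L γ b₀ p₀ (K - j) ^ 2))) ∂(T3UnitScaleTilt.gibbsK F T3UnitLawDensityEML.ℰp γ K)) /
          (∫ U, Real.exp (c₀ * ((γ * ((F.L : ℝ)⁻¹) ^ (K - j))⁻¹ *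
          ∑ a : Plaq (F.P K) j, min (GaugeGroup.dist1 (GaugeField.plaqHol
            (Averaging.iter (fun i => BlockAveraging.blockAvg (P := F.P K) (j := i) T3UnitLawDensityEML.ℰp) j U) a) ^ 2)
            (T3UnitScaleTilt.θBal F.L γ b₀ p₀ (K - j) ^ 2))) ∂(T3UnitScaleTilt.gibbsK F T3UnitLawDensityEML.ℰp γ K)) ≤
        C₀ * (Fintype.card (Plaq (F.P K) j) : ℝ) := by
  intro L b₀ p₀ hb₀ hp₀
  obtain ⟨c₁, C₁, γ₁, hc₁, hγ₁, hγ₁1, hbound⟩ := hS L b₀ p₀ hb₀ hp₀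
  refine ⟨c₁ / 2, 2 * max C₁ 0 / c₁, γ₁, by positivity, hγ₁, hγ₁1, fun F γ hFL hγ hγγ₁ K j hjK => ?_⟩
  haveI := T3UnitScaleTilt.isProbabilityMeasure_gibbsK F T3UnitLawDensityEML.ℰp hγ.le K
  set β : ℝ := (γ * ((F.L : ℝ)⁻¹) ^ (K - j))⁻¹ with hβdef
  set θ : ℝ := T3UnitScaleTilt.θBal F.L γ b₀ p₀ (K - j) with hθdef
  have hL0 : (0 : ℝ) < F.L := by exact_mod_cast (zero_lt_one.trans F.hL.2)
  have hβ0 : 0 ≤ β := by rw [hβdef]; exact (inv_pos.mpr (mul_pos hγ (pow_pos (inv_pos.mpr hL0) _))).le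
  -- the observable, its measurability, bound and sign
  set X : GaugeField (F.P K) 0 (Matrix.specialUnitaryGroup (Fin 2) ℂ) → ℝ := fun U =>
    β * ∑ a : Plaq (F.P K) j, min (GaugeGroup.dist1 (GaugeField.plaqHol
      (Averaging.iter (fun i => BlockAveraging.blockAvg (P := F.P K) (j := i) T3UnitLawDensityEML.ℰp) j U) a) ^ 2) (θ ^ 2)
    with hXdef
  have hmeas : Measurable X := by
    refine (Finset.measurable_sum _ fun a _ => ?_).const_mul β
    exact ((measurable_dist1_iter F K j a).pow_const 2).min measurable_const
  have hsum0 : ∀ U, 0 ≤ ∑ a : Plaq (F.P K) j, min (GaugeGroup.dist1 (GaugeField.plaqHol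
      (Averaging.iter (fun i => BlockAveraging.blockAvg (P := F.P K) (j := i) T3UnitLawDensityEML.ℰp) j U) a) ^ 2) (θ ^ 2) :=
    fun U => Finset.sum_nonneg fun a _ => le_min (sq_nonneg _) (sq_nonneg _)
  have hX0 : ∀ U, 0 ≤ X U := fun U => mul_nonneg hβ0 (hsum0 U)
  have hbdd : ∀ U, |X U| ≤ β * ((Fintype.card (Plaq (F.P K) j) : ℝ) * θ ^ 2) := fun U => by
    rw [abs_of_nonneg (hX0 U)]
    refine mul_le_mul_of_nonneg_left ?_ hβ0
    calc ∑ a : Plaq (F.P K) j, min (GaugeGroup.dist1 (GaugeField.plaqHol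
          (Averaging.iter (fun i => BlockAveraging.blockAvg (P := F.P K) (j := i) T3UnitLawDensityEML.ℰp) j U) a) ^ 2) (θ ^ 2)
        ≤ ∑ _a : Plaq (F.P K) j, θ ^ 2 := Finset.sum_le_sum fun a _ => min_le_right _ _
      _ = (Fintype.card (Plaq (F.P K) j) : ℝ) * θ ^ 2 := by rw [Finset.sum_const, Finset.card_univ, nsmul_eq_mul]
  -- the chord between `c₁/2` and `c₁`, and the crux at `c₁`
  have hchord := mul_tilted_mean_le_log_sub_log (T3UnitScaleTilt.gibbsK F T3UnitLawDensityEML.ℰp γ K) hmeas hbdd (c₁ / 2) (c₁ / 2)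
  have hc11 : c₁ / 2 + c₁ / 2 = c₁ := by ring
  rw [hc11] at hchord
  have hZ1 : 1 ≤ ∫ U, Real.exp (c₁ / 2 * X U) ∂(T3UnitScaleTilt.gibbsK F T3UnitLawDensityEML.ℰp γ K) :=
    one_le_integral_exp_mul _ hmeas hbdd hX0 (by positivity)
  have hlog0 : 0 ≤ Real.log (∫ U, Real.exp (c₁ / 2 * X U) ∂(T3UnitScaleTilt.gibbsK F T3UnitLawDensityEML.ℰp γ K)) :=
    Real.log_nonneg hZ1
  have hcrux : Real.log (∫ U, Real.exp (c₁ * X U) ∂(T3UnitScaleTilt.gibbsK F T3UnitLawDensityEML.ℰp γ K)) ≤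
      max C₁ 0 * (Fintype.card (Plaq (F.P K) j) : ℝ) := by
    have h := hbound F γ hFL hγ hγγ₁ K j hjK
    have hint : (fun U : GaugeField (F.P K) 0 (Matrix.specialUnitaryGroup (Fin 2) ℂ) =>
        Real.exp (c₁ * (γ * ((F.L : ℝ)⁻¹) ^ (K - j))⁻¹ *
          ∑ a : Plaq (F.P K) j, min (GaugeGroup.dist1 (GaugeField.plaqHol
            (Averaging.iter (fun i => BlockAveraging.blockAvg (P := F.P K) (j := i) T3UnitLawDensityEML.ℰp) j U) a) ^ 2)
            (T3UnitScaleTilt.θBal F.L γ b₀ p₀ (K - j) ^ 2))) = fun U => Real.exp (c₁ * X U) := by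
      funext U
      rw [hXdef, hβdef, hθdef, mul_assoc]
    rw [hint] at h
    have hpos : 0 < ∫ U, Real.exp (c₁ * X U) ∂(T3UnitScaleTilt.gibbsK F T3UnitLawDensityEML.ℰp γ K) :=
      lt_of_lt_of_le zero_lt_one (one_le_integral_exp_mul _ hmeas hbdd hX0 hc₁.le)
    calc Real.log (∫ U, Real.exp (c₁ * X U) ∂(T3UnitScaleTilt.gibbsK F T3UnitLawDensityEML.ℰp γ K))
        ≤ Real.log (Real.exp (C₁ * (Fintype.card (Plaq (F.P K) j) : ℝ))) := Real.log_le_log hpos h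
      _ = C₁ * (Fintype.card (Plaq (F.P K) j) : ℝ) := Real.log_exp _
      _ ≤ max C₁ 0 * (Fintype.card (Plaq (F.P K) j) : ℝ) := mul_le_mul_of_nonneg_right (le_max_left _ _) (Nat.cast_nonneg _)
  -- assemble: `(c₁/2)·m ≤ max C₁ 0 · #Plaq_j`
  have hm : c₁ / 2 * ((∫ U, X U * Real.exp (c₁ / 2 * X U) ∂(T3UnitScaleTilt.gibbsK F T3UnitLawDensityEML.ℰp γ K)) /
      (∫ U, Real.exp (c₁ / 2 * X U) ∂(T3UnitScaleTilt.gibbsK F T3UnitLawDensityEML.ℰp γ K))) ≤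
      max C₁ 0 * (Fintype.card (Plaq (F.P K) j) : ℝ) := by linarith
  have hc2 : 0 < c₁ / 2 := by positivity
  have hfinal : (∫ U, X U * Real.exp (c₁ / 2 * X U) ∂(T3UnitScaleTilt.gibbsK F T3UnitLawDensityEML.ℰp γ K)) /
      (∫ U, Real.exp (c₁ / 2 * X U) ∂(T3UnitScaleTilt.gibbsK F T3UnitLawDensityEML.ℰp γ K)) ≤
      2 * max C₁ 0 / c₁ * (Fintype.card (Plaq (F.P K) j) : ℝ) := by
    rw [show 2 * max C₁ 0 / c₁ * (Fintype.card (Plaq (F.P K) j) : ℝ) =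
      (max C₁ 0 * (Fintype.card (Plaq (F.P K) j) : ℝ)) / (c₁ / 2) by field_simp]
    rw [le_div_iff₀ hc2, mul_comm]
    exact hm
  exact hfinal

end Summit.QuantumFields.YangMills.Theorems.CoarseStiffnessTailCappedCoarseStiffnessLStrength

end
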